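import Summits.QuantumFields.BalabanUV.T4Continuum.Support.B13StepTermCoding

/-!
# NE5 ∕ U3, crux O1, row O1-d1 follower (iii-d) — `B13StepTermCodingBudget`: THE TERMWISE INPUTS OF THE OWNER's END E1-termwise
# OVER THE ANCHORED CODING OF RECORD, part A — line analyticity and `TermBound` for the CODED family `(anchored R).lift T` from a
# per-domain termwise majorant TRANSLATION INVARIANT in range, with the `X`-blind WEIGHT ON CODES built on the ORIGIN-PINNED domains;
# the (1.26)-type pinned shape sum (part 4a of the anchored-coding series; part 4b `B13StepTermCodingBudgetSum` = `TermBudget` + assembly)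

Cell `pub-balaban`, unit `b2b-balaban-t4-ne5-formalise-leaf-02` (NE5 formalisation swarm, leaf prover 02 — holder lineage of row
O1-d1 of `t4/b2b-balaban-t4-ne5-p1/O1-CLAIM-TABLE-NE5-P1.md` v1.3; journal INTENT l.8957 + addendum; design `B13StepDesign.md` v0.3 RULING
R9 «anchored term labels»).  Summits-side NEW WORK under the LEAN PLACEMENT RULE (cell modelling + kernel-checked bookkeeping on the swarm's
objects of record; nothing of the manuscripts under audit is asserted — [II] = [Balaban1988RG2Cluster] and [Balaban1987RG1] are cited
for KIND∕locus only).
HONEST FRAMING: rung (B)+1 bookkeeping for the FINITE-VOLUME T⁴ programme — NOT the continuum limit by itself, NOT infinite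
volume, NOT a mass gap, NOT Clay; NE5 NOT PROVED; spine 0∕9.  HONEST DEPENDENCY (cell line, verbatim): continuum YM on T⁴ ⇐ BetaPertH
∧ nine spine estimates (0/9 proved); BetaPertH ⇐ (D1) ∧ (D4) ∧ CAP+tail; G-an2-4 gates asym, D1 and NE2/3/4.

WHY.  The owner's termwise END `T4InputCauchyRateTermwise.ne5_at_of_stepModel_termwise_scale_nat` consumes `TermRep` ∕ `TermLineAnalytic`
∕ `TermBound κ a` ∕ `TermBudget a G` with `X`-BLIND weights `a k i`; over the ABSOLUTE labels the budget `Σ_i a k i ≤ G` is extensive in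
the number of domains of the step volume (this row's finding, l.5621) — design v0.3 R9 rules that the labels of record are anchored codes.
Parts 1–3 built the coding `anchored R`; this file turns per-domain termwise data into the four binders FOR THE CODED FAMILY
`(anchored R).lift T`, with a class constant that does not see the volume.

WHAT IS PROVED (kernel-checked; imports part 3 BY NAME; `G := B13DomainGeometryTR.domainGeometry R`, `D := b13InnerData R`).
* §1 (generic, any `Coding`): **`termLineAnalytic_lift`** (line analyticity transfers along a coding: the coded term at a code is one
  fixed term or `0`), **`termBound_lift`** (a termwise bound with weights read on codes transfers).
* §2 `pinned R k` (the ORIGIN-PINNED domains of `𝐃_k`), `recentre_mem_pinned`, `pinned_eq_filter_footprint`, and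
  **`pinned_shape_sum_le`**: `Σ_{S ∈ 𝐃_k, 0 ∈ S} e^{−κ₂ d S} ≤ K₀(64,8)` for `κ₂ ≥ 64·log 162` — route P2's TR THEOREM `ineq126_level`
  (the tree's reproduction of [Balaban1987RG1] (1.26) on the torus) read at the origin cube: the ONE (1.26)-type shape sum of R9.
* §3 `decodeAt X` (inverse of the code; `decodeAt_code`, `code_decodeAt`), **`codeWeight A κ₂ k i`** — IN THE MEANINGFUL RANGE
  `k + m′ ≤ m + K` the pinned shape sum `Σ_{S pinned} A k S i·e^{−κ₂ d S}`, ON THE JUNK SCALES of `B13Carriers` (iii) (tori truncated to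
  `2⁴` cubes, no covariance) the decoded sum over the whole `𝐃_k` —, `codeWeight_nonneg`, `le_codeWeight_of_range`, `le_codeWeight_of_junk`.
* §4 `majorant_eq_recentre_code` and **`termBound_anchored`**: `TermBound K ((anchored R).lift T) W κ₁ (codeWeight A κ₂)` from a
  nonnegative per-domain termwise majorant `‖T k t q X‖ ≤ A k X t·e^{−(κ₁+κ₂) d X}` on the class (displayed) that is TRANSLATION
  INVARIANT IN RANGE (displayed; printed KIND: Euclidean invariance of the action, [Balaban1987RG1] p. 263) — «at the price of a little
  decay rate» (R9): `κ₂` of the rate is spent on the shape sum.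
* §5–§6 (`TermBudget (codeWeight A κ₂) (17·Bud·K₀)` and the assembly `termwise_inputs_anchored`) are part 4b `B13StepTermCodingBudgetSum`.
DISPLAYED, asserted nowhere: the per-domain majorant `A` and its bound on `T`, its translation invariance in range, the per-domain
budgets, line analyticity of `T`.  NOT an estimate about Bałaban's (2.14) terms; no END face re-wired; 0∕12 skeleton leaves on Bałaban's
concrete objects unchanged; NE5 NOT PROVED.  0 sorry; axioms ⊆ {propext, Classical.choice, Quot.sound}.
-/

noncomputable section

namespace Summit.QuantumFields.BalabanUV.T4Continuum.B13StepTermCodingBudget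

open scoped BigOperators
open Literature.MathematicalPhysics.QuantumFieldTheory.Balaban1983to89
open Literature.MathematicalPhysics.QuantumFieldTheory.Balaban1983to89.TreeLengthTorus (TPt TDom)
open Literature.MathematicalPhysics.QuantumFieldTheory.Balaban1983to89.T4OutputRate (Carriers)
open Literature.MathematicalPhysics.QuantumFieldTheory.Balaban1983to89.T4InputCauchyRateData (StepModel)
open Literature.MathematicalPhysics.QuantumFieldTheory.Balaban1983to89.T4InputCauchyRateTermwise (TermRep TermBound TermBudget
  TermLineAnalytic)
open Summit.QuantumFields.BalabanUV.T4Continuum.B13Carriers (TwoRuns)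
open Summit.QuantumFields.BalabanUV.T4Continuum.B13InnerData (Bnd b13InnerData)
open Summit.QuantumFields.BalabanUV.T4Continuum.B13StepTermLabels (InnerLabel PolyLabel TermIdx InnerData Coding termLabels
  mem_termLabels coeff)
open Summit.QuantumFields.BalabanUV.T4Continuum.B13DomainGeometryTR (domainGeometry footprint mk_mem_footprint_iff)
open Summit.QuantumFields.BalabanUV.T4Continuum.ClusterRepOfDomains (DomainGeometry)
open Summit.QuantumFields.BalabanUV.T4Continuum.B13StepTermShift
open Summit.QuantumFields.BalabanUV.T4Continuum.B13StepTermTranslate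
open Summit.QuantumFields.BalabanUV.T4Continuum.B13StepTermCoding

/-! ## §1 Generic: line analyticity and termwise bounds TRANSFER ALONG ANY CODING -/

section Generic

variable {C : Carriers} [DecidableEq C.Dom] {Cube : Type*} [DecidableEq Cube] {Bd : Type*}
  {G : DomainGeometry C Cube} {D : InnerData C Bd} {ι₀ : Type*} (κ : Coding G D ι₀)
  {Op Hist : Type*} (K : ℕ → (ℕ → ℝ) → C.BgB → Set (Op × Hist)) (T : ℕ → TermIdx C.Dom Bd → Op → Hist → C.Dom → ℂ)

/-- [folklore] **LINE ANALYTICITY TRANSFERS ALONG A CODING**: the coded family at a code is either one fixed term of the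
original family or identically `0`, so `TermLineAnalytic K T W → TermLineAnalytic K (κ.lift T) W`. -/
theorem termLineAnalytic_lift [NormedAddCommGroup Op] [NormedSpace ℂ Op] [NormedAddCommGroup Hist] [NormedSpace ℂ Hist]
    {W : Set (ℕ → ℝ)} (hline : TermLineAnalytic K T W) : TermLineAnalytic K (κ.lift T) W := by
  classical
  intro k g hg U o u h v hseg X hX i
  by_cases hx : ∃ t : TermIdx C.Dom Bd, t.LocalizesAt G D k X ∧ κ.code k X t = i
  · simp only [Coding.lift, dif_pos hx]; exact hline k g hg U o u h v hseg X hX _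
  · simp only [Coding.lift, dif_neg hx]; exact differentiableOn_const 0

/-- [folklore] **A TERMWISE BOUND TRANSFERS ALONG A CODING** once the weights are read on codes: if on the class every
LOCALIZING term obeys `‖T k t q X‖ ≤ a k (code k X t)·e^{−κ′ d X}` with nonnegative code-weights `a`, then
`TermBound K (κ.lift T) W κ′ a`. -/
theorem termBound_lift {W : Set (ℕ → ℝ)} {κ' : ℝ} {a : ℕ → ι₀ → ℝ} (ha : ∀ k i, 0 ≤ a k i)
    (hbd : ∀ k, ∀ g ∈ W, ∀ (U : C.BgB) (q : Op × Hist), q ∈ K k g U → ∀ X : C.Dom, C.scale X = k →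
      ∀ t : TermIdx C.Dom Bd, t.LocalizesAt G D k X → ‖T k t q.1 q.2 X‖ ≤ a k (κ.code k X t) * Real.exp (-(κ' * C.d X))) :
    TermBound K (κ.lift T) W κ' a := by
  classical
  intro k g hg U q hq X hX i
  by_cases hx : ∃ t : TermIdx C.Dom Bd, t.LocalizesAt G D k X ∧ κ.code k X t = i
  · have h := hbd k g hg U q hq X hX _ (Classical.choose_spec hx).1
    rw [(Classical.choose_spec hx).2] at h
    simpa only [Coding.lift, dif_pos hx] using h
  · simp only [Coding.lift, dif_neg hx, norm_zero]
    exact mul_nonneg (ha k i) (Real.exp_nonneg _)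

end Generic

/-! ## §2 On the carriers of record: origin-pinned domains, the (1.26)-type pinned shape sum, the coded weights -/

section Record

variable {G : Type} [GaugeGroup G] {R : TwoRuns G}

variable (R) in
/-- [folklore] THE ORIGIN-PINNED DOMAINS OF LEVEL `k`: the domains of `𝐃_k` containing the origin cube of `π_k` (the index set of a
(1.26)-type shape sum; every `Dom.recentre X`, `X ∈ 𝐃_k`, is one of them). -/
def pinned (k : ℕ) : Finset R.carriers.Dom := (R.domAt k).filter fun S => (0 : TPt 4 (R.cubesPerDir S.1)) ∈ S.2.1

/-- [folklore] Membership in `pinned R k`. -/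
theorem mem_pinned {k : ℕ} {S : R.carriers.Dom} : S ∈ pinned R k ↔ S ∈ R.domAt k ∧ (0 : TPt 4 (R.cubesPerDir S.1)) ∈ S.2.1 :=
  Finset.mem_filter

/-- [folklore] The recentred domain of any `X ∈ 𝐃_k` is origin-pinned of level `k` (leaf-05's `zero_mem_recentre`). -/
theorem recentre_mem_pinned {k : ℕ} {X : R.carriers.Dom} (hX : X ∈ R.domAt k) :
    B13CarriersTranslation.Dom.recentre X ∈ pinned R k := by
  refine mem_pinned.2 ⟨?_, B13CarriersTranslation.Dom.zero_mem_recentre X⟩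
  rw [TwoRuns.mem_domAt] at hX ⊢
  exact hX

/-- [folklore] The pinned domains of level `k` are the level-`k` domains whose footprint contains the sigma cube `⟨k, 0⟩`. -/
theorem pinned_eq_filter_footprint (k : ℕ) :
    pinned R k = (R.domAt k).filter fun S => (⟨k, 0⟩ : B13DomainGeometryTR.SCube R) ∈ footprint S := by
  refine Finset.filter_congr fun S hS => ?_
  obtain ⟨j, Y⟩ := S
  have hj : j = k := R.mem_domAt.1 hS
  subst hj
  exact mk_mem_footprint_iff.symm

/-- [folklore] **THE (1.26)-TYPE PINNED SHAPE SUM IS BOUNDED, VOLUME-UNIFORMLY**: for `κ₂ ≥ 64·log 162`,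
`Σ_{S ∈ 𝐃_k, 0 ∈ S} e^{−κ₂ d S} ≤ K₀(64, 8)` — route P2's TR theorem `ineq126_level` (the tree's reproduction of [Balaban1987RG1]
(1.26) on the torus) read at the origin cube, and monotonicity in the rate. -/
theorem pinned_shape_sum_le {k : ℕ} {κ₂ : ℝ} (hκ : 64 * Real.log 162 ≤ κ₂) :
    ∑ S ∈ pinned R k, Real.exp (-(κ₂ * R.carriers.d S)) ≤ B12TreeDecay.K₀ (4 * 2 ^ 4) (2 * 4) := by
  rw [pinned_eq_filter_footprint]
  refine le_trans (Finset.sum_le_sum fun S _ => ?_) (B13DomainGeometryTR.ineq126_level (R := R) k ⟨k, 0⟩)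
  exact Real.exp_le_exp.2 (neg_le_neg (mul_le_mul_of_nonneg_right hκ (R.carriers.d_nonneg S)))

end Record

/-! ## §3 The weights on codes; `TermBound` and `TermBudget` for the coded family -/

section Budget

variable {G : Type} [GaugeGroup G] {R : TwoRuns G}

open B13CarriersTranslation (Dom.anchor Dom.recentre Dom.zero_mem_recentre Dom.d_recentre)

/-- [folklore] DECODING relative to `X`: the inverse of the anchored code (`translate (scale X) (+anchor X)`). -/
def decodeAt (X : R.carriers.Dom) (i : TermIdx R.carriers.Dom (Bnd R)) : TermIdx R.carriers.Dom (Bnd R) :=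
  TermIdx.translate X.1 (Dom.anchor X) i

/-- [folklore] Decoding undoes coding. -/
@[simp] theorem decodeAt_code (k : ℕ) (X : R.carriers.Dom) (t : TermIdx R.carriers.Dom (Bnd R)) :
    decodeAt X ((anchored R).code k X t) = t :=
  TermIdx.translate_translate_neg X.1 _ t

/-- [folklore] Coding undoes decoding. -/
@[simp] theorem code_decodeAt (k : ℕ) (X : R.carriers.Dom) (i : TermIdx R.carriers.Dom (Bnd R)) :
    (anchored R).code k X (decodeAt X i) = i :=
  TermIdx.translate_neg_translate X.1 _ i

/-- [folklore] In the meaningful range the output scale's membership is decidable bookkeeping. -/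
instance instDecidableRange (k : ℕ) : Decidable (k + R.m' ≤ R.F.m + R.K) := inferInstance

/-- [folklore] **THE WEIGHT ON CODES** of a per-domain termwise majorant `A k X t` at the auxiliary rate `κ₂`.  IN THE MEANINGFUL
RANGE `k + m′ ≤ m + K`: the origin-pinned shape sum `Σ_{S ∈ 𝐃_k, 0 ∈ S} A k S i · e^{−κ₂ d S}` (an `X`-blind weight which, by the
translation invariance of `A`, dominates `A k X t · e^{−κ₂ d X}` at `i = code k X t` — the recentred domain of `X` is one of the `S`).
ON THE JUNK SCALES of `B13Carriers` (tori truncated to `2⁴` cubes, no covariance): the plain sum over `𝐃_k` read through the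
decoding, `Σ_{X′ ∈ 𝐃_k} A k X′ (decodeAt X′ i) · e^{−κ₂ d X′}` (extensive in `#𝐃_k`, which is `≤` a constant there). -/
def codeWeight (A : ℕ → R.carriers.Dom → TermIdx R.carriers.Dom (Bnd R) → ℝ) (κ₂ : ℝ) (k : ℕ)
    (i : TermIdx R.carriers.Dom (Bnd R)) : ℝ :=
  if k + R.m' ≤ R.F.m + R.K then ∑ S ∈ pinned R k, A k S i * Real.exp (-(κ₂ * R.carriers.d S))
  else ∑ X ∈ R.domAt k, A k X (decodeAt X i) * Real.exp (-(κ₂ * R.carriers.d X))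

/-- [folklore] The weight on codes is nonnegative for a nonnegative majorant. -/
theorem codeWeight_nonneg {A : ℕ → R.carriers.Dom → TermIdx R.carriers.Dom (Bnd R) → ℝ} (hA : ∀ k X t, 0 ≤ A k X t) (κ₂ : ℝ)
    (k : ℕ) (i : TermIdx R.carriers.Dom (Bnd R)) : 0 ≤ codeWeight A κ₂ k i := by
  unfold codeWeight
  split_ifs
  · exact Finset.sum_nonneg fun S _ => mul_nonneg (hA k S i) (Real.exp_nonneg _)
  · exact Finset.sum_nonneg fun X _ => mul_nonneg (hA k X _) (Real.exp_nonneg _)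

/-- [folklore] IN RANGE: the weight at the code of a label localizing at `X ∈ 𝐃_k` dominates `A k (recentre X) (code) · e^{−κ₂ d X}`
(the recentred domain is one pinned shape; `d (recentre X) = d X`). -/
theorem le_codeWeight_of_range {A : ℕ → R.carriers.Dom → TermIdx R.carriers.Dom (Bnd R) → ℝ} (hA : ∀ k X t, 0 ≤ A k X t)
    (κ₂ : ℝ) {k : ℕ} (hk : k + R.m' ≤ R.F.m + R.K) {X : R.carriers.Dom} (hX : X ∈ R.domAt k)
    (i : TermIdx R.carriers.Dom (Bnd R)) :
    A k (Dom.recentre X) i * Real.exp (-(κ₂ * R.carriers.d X)) ≤ codeWeight A κ₂ k i := by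
  rw [codeWeight, if_pos hk, ← Dom.d_recentre X]
  exact Finset.single_le_sum (f := fun S => A k S i * Real.exp (-(κ₂ * R.carriers.d S)))
    (fun S _ => mul_nonneg (hA k S i) (Real.exp_nonneg _)) (recentre_mem_pinned hX)

/-- [folklore] ON JUNK SCALES: the weight at the code of a label localizing at `X ∈ 𝐃_k` dominates `A k X t · e^{−κ₂ d X}` (the
term `X′ = X` of the sum, decoding the code). -/
theorem le_codeWeight_of_junk {A : ℕ → R.carriers.Dom → TermIdx R.carriers.Dom (Bnd R) → ℝ} (hA : ∀ k X t, 0 ≤ A k X t)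
    (κ₂ : ℝ) {k : ℕ} (hk : ¬ k + R.m' ≤ R.F.m + R.K) {X : R.carriers.Dom} (hX : X ∈ R.domAt k)
    (t : TermIdx R.carriers.Dom (Bnd R)) :
    A k X t * Real.exp (-(κ₂ * R.carriers.d X)) ≤ codeWeight A κ₂ k ((anchored R).code k X t) := by
  rw [codeWeight, if_neg hk]
  have h := Finset.single_le_sum (f := fun X' => A k X' (decodeAt X' ((anchored R).code k X t)) * Real.exp (-(κ₂ * R.carriers.d X')))
    (fun X' _ => mul_nonneg (hA k X' _) (Real.exp_nonneg _)) hX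
  simpa only [decodeAt_code] using h

end Budget

/-! ## §4 The termwise inputs of the owner's END E1-termwise for the CODED family -/

section Termwise

variable {G : Type} [GaugeGroup G] {R : TwoRuns G}
variable {Op Hist : Type*}

open B13CarriersTranslation (Dom.anchor Dom.recentre Dom.zero_mem_recentre Dom.d_recentre)

/-- [folklore] IN RANGE, TRANSLATION INVARIANCE READS THE MAJORANT AT THE RECENTRED DOMAIN: `A k X t = A k (recentre X) (code k X t)`
for `X = ⟨k, Y⟩`. -/
theorem majorant_eq_recentre_code {A : ℕ → R.carriers.Dom → TermIdx R.carriers.Dom (Bnd R) → ℝ} {k : ℕ}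
    (hAinv : ∀ (Y : TDom 4 (R.cubesPerDir k)) (v : TPt 4 (R.cubesPerDir k)) (t : TermIdx R.carriers.Dom (Bnd R)),
      A k (translateAt k v ⟨k, Y⟩) (TermIdx.translate k v t) = A k ⟨k, Y⟩ t)
    (Y : TDom 4 (R.cubesPerDir k)) (t : TermIdx R.carriers.Dom (Bnd R)) :
    A k ⟨k, Y⟩ t = A k (Dom.recentre (⟨k, Y⟩ : R.carriers.Dom)) ((anchored R).code k ⟨k, Y⟩ t) := by
  rw [recentre_eq_translateAt, anchored_code]
  exact (hAinv Y (-Dom.anchor (⟨k, Y⟩ : R.carriers.Dom)) t).symm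

/-- [folklore] **`TermBound` FOR THE CODED FAMILY** at rate `κ₁` with the weight on codes `codeWeight A κ₂`, from a nonnegative
per-domain termwise majorant `A` of rate `κ₁ + κ₂` on the class (displayed), TRANSLATION INVARIANT IN THE MEANINGFUL RANGE (displayed;
printed KIND: the Euclidean invariance of the action, [Balaban1987RG1] p. 263) — «at the price of a little decay rate» (R9): the part
`κ₂` of the rate is spent on the shape sum. -/
theorem termBound_anchored (K : ℕ → (ℕ → ℝ) → R.carriers.BgB → Set (Op × Hist))
    (T : ℕ → TermIdx R.carriers.Dom (Bnd R) → Op → Hist → R.carriers.Dom → ℂ)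
    {A : ℕ → R.carriers.Dom → TermIdx R.carriers.Dom (Bnd R) → ℝ} {W : Set (ℕ → ℝ)} {κ₁ κ₂ : ℝ}
    (hA : ∀ k X t, 0 ≤ A k X t)
    (hAinv : ∀ k, k + R.m' ≤ R.F.m + R.K → ∀ (Y : TDom 4 (R.cubesPerDir k)) (v : TPt 4 (R.cubesPerDir k))
      (t : TermIdx R.carriers.Dom (Bnd R)), A k (translateAt k v ⟨k, Y⟩) (TermIdx.translate k v t) = A k ⟨k, Y⟩ t)
    (hbd : ∀ k, ∀ g ∈ W, ∀ (U : R.carriers.BgB) (q : Op × Hist), q ∈ K k g U → ∀ X : R.carriers.Dom, R.carriers.scale X = k →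
      ∀ t : TermIdx R.carriers.Dom (Bnd R), t.LocalizesAt (domainGeometry R) (b13InnerData R) k X →
        ‖T k t q.1 q.2 X‖ ≤ A k X t * Real.exp (-((κ₁ + κ₂) * R.carriers.d X))) :
    TermBound K ((anchored R).lift T) W κ₁ (codeWeight A κ₂) := by
  refine termBound_lift (anchored R) K T (fun k i => codeWeight_nonneg hA κ₂ k i) fun k g hg U q hq X hX t ht => ?_
  have hXk : X ∈ R.domAt k := R.mem_domAt.2 hX
  refine (hbd k g hg U q hq X hX t ht).trans ?_
  rw [show A k X t * Real.exp (-((κ₁ + κ₂) * R.carriers.d X)) =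
      A k X t * Real.exp (-(κ₂ * R.carriers.d X)) * Real.exp (-(κ₁ * R.carriers.d X)) by
    rw [add_mul, neg_add, Real.exp_add]; ring]
  refine mul_le_mul_of_nonneg_right ?_ (Real.exp_nonneg _)
  by_cases hk : k + R.m' ≤ R.F.m + R.K
  · obtain ⟨j, Y⟩ := X
    have hj : j = k := hX
    subst hj
    rw [majorant_eq_recentre_code (hAinv j hk) Y t]
    exact le_codeWeight_of_range hA κ₂ hk hXk _
  · exact le_codeWeight_of_junk hA κ₂ hk hXk t

end Termwise

end Summit.QuantumFields.BalabanUV.T4Continuum.B13StepTermCodingBudget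

end
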